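import Literature.NumberTheory.EllipticCurves.GreenbergSelmer
import HarnessLib

/-!
# Greenberg–Vatsal, *On the Iwasawa invariants of elliptic curves* (Invent. Math. 142 (2000)),
# §2 pp. 16–17, 20, 23: the Greenberg-datum Selmer groups `S_A(ℚ_∞)`, `S^{Σ₀}_A(ℚ_∞)` and their
# STRICT variants `S^{str}_A(ℚ_∞)`, `S^{Σ₀,str}_A(ℚ_∞)` (DEFINITIONS ONLY — every `def` has a body;
# nothing is asserted)

HONEST FRAMING (BSD rank-`≤ 1` residual cell `b2b-bsdres`, home
`run/shared/lean/b2b/bsd-rank1-residual/`, unit `b2b-bsdres-eisenstein-p2`): the cell deletes the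
COMBINATION-SHAPED residual classes of the rank-`≤ 1` BSD formula from PUBLISHED theorems only and
TYPES the construction-shaped ones; this is not "finishing BSD". This file only NAMES, in the tree's
`GreenbergSelmer` vocabulary (file `Literature/NumberTheory/EllipticCurves/GreenbergSelmer.lean`:
`subgroupH1 H M = H¹(H, M)`, `conjH1`, `inertiaIn`, `LocalDatum`, `greenbergKer`, `strictKer`),
the four Selmer groups of Greenberg–Vatsal's §2, so that §2's PRINTED statements about them
(Prop. (2.1) and its proof p. 20, Cor. (2.3), Prop. (2.5), Prop. (2.8), pp. 14–15) can be recorded as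
Literature named facts. The cell's Summits files (`Summits/BirchSwinnertonDyer/Rank1Residual/X2/
GreenbergVatsalTorsion.lean`, gen 8, `gvSelmer`; `…/X2/GreenbergVatsalStrictSelmer.lean`, gen 12,
`gvStrictSelmer`) defined the same groups Summits-side by the SAME formulas; the Summits bridge
`X2/GreenbergSelmerGroupsBridge.lean` records the definitional equalities.

GV §2 (p. 16): `Σ ∋ p, ∞` finite; `A = V_p/T_p` a discrete `Gal(ℚ_Σ/ℚ)`-module, `C ⊂ A` the image of a
`G_{ℚ_p}`-invariant subspace `W_p`, `D = A/C`;
"`S_A(ℚ_∞) = ker ( H¹(ℚ_Σ/ℚ_∞, A) → ∏_{ℓ∈Σ} 𝓗_ℓ(ℚ_∞, A) )` where … if `ℓ ≠ p`, we simply let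
`𝓗_ℓ(ℚ_∞, A) = ∏_{η∣ℓ} H¹((ℚ_∞)_η, A)` … `𝓗_p(ℚ_∞, A) = H¹((ℚ_∞)_𝔭, A)/L_𝔭` where
`L_𝔭 = ker ( H¹((ℚ_∞)_𝔭, A) → H¹(I_𝔭, D) )`. Thus … `[σ]` is in `S_A(ℚ_∞)` if and only if `[σ|_{I_𝔭}]`
is in the image of the map `H¹(I_𝔭, C) → H¹(I_𝔭, A)` and `[σ|_{G_{(ℚ_∞)_η}}] = 0` for all `η ∣ ℓ`,
`ℓ ∈ Σ` with `ℓ ≠ p`." (p. 17:) "`G_{(ℚ_∞)_η}/I_η` has profinite degree prime to `p`. So the last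
condition is equivalent to `[σ|_{I_η}] = 0`". (p. 20:) "The non-primitive Selmer group for `A` and
`Σ₀` [`∌ p, ∞`] is defined by `S^{Σ₀}_A(ℚ_∞) = ker ( H¹(ℚ_Σ/ℚ_∞, A) → ∏_{ℓ∈Σ−Σ₀} 𝓗_ℓ(ℚ_∞) )`.
Obviously, `S_A(ℚ_∞) ⊆ S^{Σ₀}_A(ℚ_∞)`." (p. 20, proof of Prop. (2.1):) "the kernel of `γ'₀` [the map
to `H¹((ℚ_∞)_𝔭, A/C) × ∏_{ℓ≠p} 𝓗_ℓ(ℚ_∞)`] is the strict Selmer group `S^{str}_A(ℚ_∞)`" — Greenberg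
1989 p. 98: "replace `I_v` by `D_v` … the 'strict' Selmer group". (p. 23:) "`S^{Σ₀}_A(ℚ_∞)` doesn't
depend on the choice of `Σ`, as long as `Σ₀ ∪ {p, ∞}` is contained in `Σ` … we may therefore take
`Σ = Σ₀ ∪ {p, ∞}`."

In the tree's place-by-place formalism (any number field `K`, normal `H ≤ Γ_K` with fixed field
`L` — `H = ker κ` for `L = K_∞` —, discrete `Γ_K`-module `M`, Greenberg data `L = (M⁺_v)_{v∣p}`,
finite set `S₀` of places of `K`): "unramified outside `Σ = S₀ ∪ {v ∣ p} ∪ ∞`" and "no condition at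
`S₀`" are spelled by intersecting, over all `σ ∈ Γ_K` (= all places of `L` above `v`), the
unramified condition at every finite `v ∉ S₀`, `v ∤ p`; the archimedean factor `𝓗_∞` is OMITTED
(vacuous for odd `p` and `p`-primary `M`; GV assume `p` odd throughout §2).

* `unramifiedKer H M v` — `ker (H¹(H, M) → H¹(H ⊓ I_v, M))`;
* `unramifiedOutside H M p S₀` — GV's `H¹(ℚ_Σ/ℚ_∞, A)` with `Σ = S₀ ∪ {p, ∞}`;
* `datumSelmer H M p L S₀ = S^{S₀}_M(L)` (GV's `S^{Σ₀}_A(ℚ_∞)`; `S₀ = ∅` gives `S_A(ℚ_∞)`);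
* `datumStrictSelmer H M p L S₀ = S^{S₀,str}_M(L)` (strict condition at `v ∣ p`);
* `datumSelmerInfty κ`, `datumStrictSelmerInfty κ` — the `ℤ_p`-extension spellings (`H = ker κ`).
NOT here: any statement about these groups (they are the Literature facts citing this file).
-/

noncomputable section

open scoped Classical

open NumberField IsDedekindDomain Field
open Literature.NumberTheory.EllipticCurves Literature.NumberTheory.EllipticCurves.GreenbergSelmer
  Literature.NumberTheory.GaloisRepresentations

universe u

namespace Literature.NumberTheory.EllipticCurves.GreenbergVatsal2000

variable {K : Type u} [Field K] [NumberField K]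

/-! ## §1. Local condition away from `p`: unramified classes -/

section Unramified

variable (H : Subgroup (absoluteGaloisGroup K)) (M : Type u) [AddCommGroup M]
  [DistribMulAction (absoluteGaloisGroup K) M] [TopologicalSpace M] [DiscreteTopology M]

/-- The **unramified condition at the finite place `v`** (chosen place of `L = K̄^H` above `v`): the
kernel of the restriction `H¹(H, M) → H¹(H ⊓ I_v, M)` to the inertia group (GV p. 17: "`G_η/I_η`
has profinite degree prime to `p`. So the last condition is equivalent to `[σ|_{I_η}] = 0`"; and the
classes of `H¹(ℚ_Σ/ℚ_∞, A)` are those unramified at every `η ∤ Σ`).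
[cite: GreenbergVatsal2000, §2 p. 17] -/
def unramifiedKer (v : HeightOneSpectrum (𝓞 K)) : AddSubgroup (subgroupH1 H M) :=
  (resH1Hom (inertiaInToH H v) (AddMonoidHom.id M) fun _ _ ↦ rfl).ker

variable [H.Normal] (p : ℕ) (S₀ : Set (HeightOneSpectrum (𝓞 K)))

/-- **`H¹(ℚ_Σ/ℚ_∞, A)` with `Σ = S₀ ∪ {p, ∞}`** in the place-by-place formalism: the classes of
`H¹(H, M)` which, conjugated by every `σ ∈ Γ_K` (i.e. at every place of `L` above `v`), are
unramified at each finite `v ∉ S₀` with `v ∤ p` (GV p. 16 "`H¹(ℚ_Σ/ℚ_∞, A)`"; p. 23 "we may therefore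
take `Σ = Σ₀ ∪ {p, ∞}`"). [cite: GreenbergVatsal2000, §2 pp. 16, 23] -/
def unramifiedOutside : AddSubgroup (subgroupH1 H M) :=
  ⨅ (v : HeightOneSpectrum (𝓞 K)) (_ : v ∉ S₀) (_ : ((p : ℕ) : 𝓞 K) ∉ v.asIdeal)
    (σ : absoluteGaloisGroup K), (unramifiedKer H M v).comap (conjH1 H M σ)

variable {H M p S₀} in
/-- Membership in `unramifiedOutside`. [cite: GreenbergVatsal2000, §2 pp. 16, 23] -/
theorem mem_unramifiedOutside_iff (c : subgroupH1 H M) :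
    c ∈ unramifiedOutside H M p S₀ ↔
      ∀ (v : HeightOneSpectrum (𝓞 K)), v ∉ S₀ → ((p : ℕ) : 𝓞 K) ∉ v.asIdeal →
        ∀ σ : absoluteGaloisGroup K, conjH1 H M σ c ∈ unramifiedKer H M v := by
  simp only [unramifiedOutside, AddSubgroup.mem_iInf, AddSubgroup.mem_comap]

end Unramified

/-! ## §2. `S^{Σ₀}_A` and `S^{Σ₀,str}_A` over `L = K̄^H` -/

section Defs

variable (H : Subgroup (absoluteGaloisGroup K)) [H.Normal] (M : Type u) [AddCommGroup M]
  [DistribMulAction (absoluteGaloisGroup K) M] [TopologicalSpace M] [DiscreteTopology M]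
  (p : ℕ) (L : Data K M p) (S₀ : Set (HeightOneSpectrum (𝓞 K)))

/-- **Greenberg–Vatsal's non-primitive Selmer group `S^{S₀}_M(L) ⊆ H¹(H, M)`** for the Greenberg
data `L = (M⁺_v)_{v∣p}`: the classes `c` such that, for every `σ ∈ Γ_K`, `conj_σ c` is unramified at
each finite `v ∉ S₀` with `v ∤ p` and satisfies Greenberg's INERTIA condition
`res ↦ 0 ∈ H¹(H ⊓ I_v, M/M⁺_v)` at each `v ∣ p` (`LocalDatum.greenbergKer`): GV p. 20
"`S^{Σ₀}_A(ℚ_∞) = ker ( H¹(ℚ_Σ/ℚ_∞, A) → ∏_{ℓ∈Σ−Σ₀} 𝓗_ℓ(ℚ_∞) )`" with `Σ = S₀ ∪ {p, ∞}` (p. 23),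
`𝓗_p` built from `L_𝔭 = ker (H¹((ℚ_∞)_𝔭, A) → H¹(I_𝔭, D))` (p. 16), archimedean factor omitted
(odd `p`). For `S₀ = ∅` this is GV's `S_A(ℚ_∞)` (p. 16; p. 17 for the equivalence of
`[σ|_{G_η}] = 0` with `[σ|_{I_η}] = 0` at `ℓ ∈ Σ`, `ℓ ≠ p`). Same formula as the cell's Summits-side
`X2.GreenbergVatsalTorsion.gvSelmer` (gen 8). [cite: GreenbergVatsal2000, §2 pp. 16–17, 20, 23] -/
def datumSelmer : AddSubgroup (subgroupH1 H M) :=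
  unramifiedOutside H M p S₀ ⊓
    ⨅ (v : HeightOneSpectrum (𝓞 K)) (hv : ((p : ℕ) : 𝓞 K) ∈ v.asIdeal) (σ : absoluteGaloisGroup K),
      ((L v hv).greenbergKer H).comap (conjH1 H M σ)

/-- **The STRICT non-primitive Selmer group `S^{S₀,str}_M(L) ⊆ H¹(H, M)`**: as `datumSelmer` with
the DECOMPOSITION-group condition `res ↦ 0 ∈ H¹(H ⊓ D_v, M/M⁺_v)` at each `v ∣ p`
(`LocalDatum.strictKer`; Greenberg 1989 p. 98 "replace `I_v` by `D_v` … the 'strict' Selmer group";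
GV p. 20 "the kernel of `γ'₀` is the strict Selmer group `S^{str}_A(ℚ_∞)`", p. 15). For `S₀ = ∅`
this is `S^{str}_A(ℚ_∞)`. Same formula as the cell's Summits-side
`X2.GreenbergVatsalStrictSelmer.gvStrictSelmer` (gen 12).
[cite: GreenbergVatsal2000, §2 pp. 15, 20] -/
def datumStrictSelmer : AddSubgroup (subgroupH1 H M) :=
  unramifiedOutside H M p S₀ ⊓
    ⨅ (v : HeightOneSpectrum (𝓞 K)) (hv : ((p : ℕ) : 𝓞 K) ∈ v.asIdeal) (σ : absoluteGaloisGroup K),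
      ((L v hv).strictKer H).comap (conjH1 H M σ)

variable {H M p L S₀} in
/-- Membership in `S^{S₀}_M(L)`. [cite: GreenbergVatsal2000, §2 pp. 16–17, 20] -/
theorem mem_datumSelmer_iff (c : subgroupH1 H M) :
    c ∈ datumSelmer H M p L S₀ ↔
      c ∈ unramifiedOutside H M p S₀ ∧
        ∀ (v : HeightOneSpectrum (𝓞 K)) (hv : ((p : ℕ) : 𝓞 K) ∈ v.asIdeal)
          (σ : absoluteGaloisGroup K), conjH1 H M σ c ∈ (L v hv).greenbergKer H := by
  simp only [datumSelmer, AddSubgroup.mem_inf, AddSubgroup.mem_iInf, AddSubgroup.mem_comap]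

variable {H M p L S₀} in
/-- Membership in `S^{S₀,str}_M(L)`. [cite: GreenbergVatsal2000, §2 pp. 15, 20] -/
theorem mem_datumStrictSelmer_iff (c : subgroupH1 H M) :
    c ∈ datumStrictSelmer H M p L S₀ ↔
      c ∈ unramifiedOutside H M p S₀ ∧
        ∀ (v : HeightOneSpectrum (𝓞 K)) (hv : ((p : ℕ) : 𝓞 K) ∈ v.asIdeal)
          (σ : absoluteGaloisGroup K), conjH1 H M σ c ∈ (L v hv).strictKer H := by
  simp only [datumStrictSelmer, AddSubgroup.mem_inf, AddSubgroup.mem_iInf, AddSubgroup.mem_comap]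

/-- `S^{S₀,str}_M(L) ≤ S^{S₀}_M(L)` (the strict condition implies Greenberg's, place by place:
`LocalDatum.strictKer_le_greenbergKer`; GV p. 15 "`S_{E[p^∞]}(ℚ_∞)` is actually bigger" — i.e. not
smaller). [cite: GreenbergVatsal2000, §2 pp. 15, 20] -/
theorem datumStrictSelmer_le_datumSelmer :
    datumStrictSelmer H M p L S₀ ≤ datumSelmer H M p L S₀ := by
  intro c hc
  rw [mem_datumStrictSelmer_iff] at hc
  rw [mem_datumSelmer_iff]
  exact ⟨hc.1, fun v hv σ ↦ (L v hv).strictKer_le_greenbergKer H (hc.2 v hv σ)⟩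

/-- `S^{S₀}_M(L) ≤ H¹(ℚ_Σ/ℚ_∞, ·)` (`unramifiedOutside`): forgetting the condition at `p`.
[cite: GreenbergVatsal2000, §2 p. 20] -/
theorem datumSelmer_le_unramifiedOutside :
    datumSelmer H M p L S₀ ≤ unramifiedOutside H M p S₀ :=
  fun _ hc ↦ ((mem_datumSelmer_iff _).1 hc).1

/-- `S^{S₀}` is monotone in `S₀` (GV p. 20 "Obviously, `S_A(ℚ_∞) ⊆ S^{Σ₀}_A(ℚ_∞)`").
[cite: GreenbergVatsal2000, §2 p. 20] -/
theorem datumSelmer_mono {S₀ S₁ : Set (HeightOneSpectrum (𝓞 K))} (h : S₀ ⊆ S₁) :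
    datumSelmer H M p L S₀ ≤ datumSelmer H M p L S₁ := by
  intro c hc
  rw [mem_datumSelmer_iff, mem_unramifiedOutside_iff] at hc ⊢
  exact ⟨fun v hv hpv σ ↦ hc.1 v (fun hv' ↦ hv (h hv')) hpv σ, hc.2⟩

/-- `S^{S₀,str}` is monotone in `S₀`. [cite: GreenbergVatsal2000, §2 p. 20] -/
theorem datumStrictSelmer_mono {S₀ S₁ : Set (HeightOneSpectrum (𝓞 K))} (h : S₀ ⊆ S₁) :
    datumStrictSelmer H M p L S₀ ≤ datumStrictSelmer H M p L S₁ := by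
  intro c hc
  rw [mem_datumStrictSelmer_iff, mem_unramifiedOutside_iff] at hc ⊢
  exact ⟨fun v hv hpv σ ↦ hc.1 v (fun hv' ↦ hv (h hv')) hpv σ, hc.2⟩

end Defs

/-! ## §3. Over the top of a `ℤ_p`-extension (`H = ker κ`; GV: `ℚ_∞`, `κ` cyclotomic) -/

section Tower

variable {p : ℕ} [Fact p.Prime] (κ : ZpExtension K p) (M : Type u) [AddCommGroup M]
  [DistribMulAction (absoluteGaloisGroup K) M] [TopologicalSpace M] [DiscreteTopology M]
  (L : Data K M p) (S₀ : Set (HeightOneSpectrum (𝓞 K)))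

/-- **`S^{S₀}_M(K_∞)`** — GV's `S^{Σ₀}_A(ℚ_∞)` for `K = ℚ`, `κ` cyclotomic (`S₀ = ∅`: `S_A(ℚ_∞)`).
Same formula as the Summits-side `X2.GreenbergVatsalTorsion.gvSelmerInfty`.
[cite: GreenbergVatsal2000, §2 pp. 16–17, 20] -/
def datumSelmerInfty : AddSubgroup (subgroupH1 κ.kerSubgroup M) :=
  datumSelmer κ.kerSubgroup M p L S₀

/-- **`S^{S₀,str}_M(K_∞)`** — GV's strict group over `ℚ_∞` (`S₀ = ∅`: `S^{str}_A(ℚ_∞)`). Same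
formula as the Summits-side `X2.GreenbergVatsalStrictSelmer.gvStrictSelmerInfty`.
[cite: GreenbergVatsal2000, §2 pp. 15, 20] -/
def datumStrictSelmerInfty : AddSubgroup (subgroupH1 κ.kerSubgroup M) :=
  datumStrictSelmer κ.kerSubgroup M p L S₀

/-- Unfolding (definitional). [cite: GreenbergVatsal2000, §2 p. 20] -/
theorem datumSelmerInfty_eq : datumSelmerInfty κ M L S₀ = datumSelmer κ.kerSubgroup M p L S₀ :=
  rfl

/-- Unfolding (definitional). [cite: GreenbergVatsal2000, §2 p. 20] -/
theorem datumStrictSelmerInfty_eq :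
    datumStrictSelmerInfty κ M L S₀ = datumStrictSelmer κ.kerSubgroup M p L S₀ :=
  rfl

/-- `S^{S₀,str}_M(K_∞) ≤ S^{S₀}_M(K_∞)`. [cite: GreenbergVatsal2000, §2 pp. 15, 20] -/
theorem datumStrictSelmerInfty_le_datumSelmerInfty :
    datumStrictSelmerInfty κ M L S₀ ≤ datumSelmerInfty κ M L S₀ :=
  datumStrictSelmer_le_datumSelmer κ.kerSubgroup M p L S₀

end Tower

end Literature.NumberTheory.EllipticCurves.GreenbergVatsal2000

end
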